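import Literature.AlgebraicGeometry.Motives.JacobianThetaDivisorOfCurveIso
import Literature.AlgebraicGeometry.Motives.JacobianBasePoint
import Literature.AlgebraicGeometry.Motives.JacobianBrillNoetherLocusIrreducible
import Literature.AlgebraicGeometry.Motives.JacobianThetaDivisorTranslate
import Literature.AlgebraicGeometry.Motives.AbelianVarietyWeilPairingDivisorClass
import Literature.AlgebraicGeometry.Motives.AbelianVarietyPrincipalPolarizationMultiplicity
import Literature.AlgebraicGeometry.Motives.CartierDivisorEffective
import Literature.AlgebraicGeometry.Motives.CartierDivisorMultiplicityOfIrreducibleSupport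
import HarnessLib

/-!
# Two principal Riemann theta divisors of one Jacobian have the same level pairings ((Θ-uniq)), granted the
# multiplicity of an effective divisor on an irreducible support — and hence «(F-P2) ⟺ (C)» (Lange 2023 §4.1–4.2; Birkenhake–Lange §12.3)

Layer `Literature/AlgebraicGeometry/Motives`, namespaces `Literature.AlgebraicGeometry.Motives.AbelianVariety` (§3) and
`Literature.AlgebraicGeometry.Motives.Jacobian` (§§1, 2, 4, 5).  KERNEL ONLY: theorems; no definition, no named fact, no instance,
no `sorry`.  Route G3 of the cell `hodgecm-mathlib` (D-0151) price sheet for fan-B row VI-8 (director ruling s221 (1): count-neutral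
PROOF-lane capital), glue file; leaves BY NAME: ★ `Jacobian.isIrreducible_brillNoetherLocus` (A-p04 (g17)),
★ `AbelianVariety.eq_one_of_isPrincipalPolarizationDivisor_smul` (A-p09 (g15), `AbelianVarietyPrincipalPolarizationMultiplicity`),
★ `AbelianVariety.IsPrincipalPolarizationDivisor.pullback_translation` (A-p03 (g13), `JacobianThetaDivisorTranslate`),
★ `AbelianVariety.weilPairingLevel_pullback_translation` (`AbelianVarietyLevelAdjointTranslates`), and A-p04 (g17)'s ★ bricks
`Jacobian.galoisCover_pullback_isWeilPairingAdjoint_norm_iff[_thetaUniq]` (`JacobianGaloisCoverNormAdjointIff`, `JacobianThetaDivisorOfCurveIso`).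

## The mathematics ([Lange2023AbelianVarietiesComplex] §4.1.2 Prop. 4.1.2, §4.2.1 Lemma 4.2.1 (ii), Cor. 4.2.4)

(Θ-uniq): let `Θ`, `Θ′` be Riemann theta divisors of the Jacobian `J` of a smooth projective complex curve (`dim J ≥ 1`) — effective
Cartier divisors whose supports are translates `t_x W̃_{g−1}(P)`, `t_{x′} W̃_{g−1}(P′)` of Brill–Noether loci — both defining PRINCIPAL
polarisations.  Then `ē_N^Θ = ē_N^{Θ′}` at every level `N`.  Proof: (i) the loci of two base points are translates of each other
(`W̃_r(P′) = t_{c^r} W̃_r(P)`, `c = [P − P′]`, [Milne1986JacobianVarieties] §2/§6), so `supp Θ′ = t_y(supp Θ)` for a point `y`, i.e. the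
TRANSLATE `Θ″ := t_{y⁻¹}^* Θ` has the support of `Θ′`; it is again a principal polarisation divisor and `ē^{Θ″} = ē^{Θ}` (theorem of the
square, ★ `weilPairingLevel_pullback_translation`); (ii) the common support is IRREDUCIBLE (closure of the image of the irreducible `C^{g−1}`),
so by the MULTIPLICITY LETTER — «two effective Cartier divisors with the same irreducible support are `m″ • D`, `m′ • D` for one divisor
`D`» (Hartshorne II.6.11 on the locally factorial `J`; taken here as the HYPOTHESIS `hmult`, discharged in-tree separately) — `Θ″ ≈ m″ • D`,
`Θ′ ≈ m′ • D`; (iii) a principal polarisation divisor `m • D` on an abelian variety of positive dimension has `m = 1`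
(`A[m] ≤ K(m • D) = 0` forces `m = 1`, [MumfordAV1970] §6 App. 3 / §8 (iv)); hence `Θ″ ≈ D ≈ Θ′` and `ē^Θ = ē^{Θ″} = ē^D = ē^{Θ′}`.

With A-p04 (g17)'s kernel bricks «(F-P2) ⟺ (C) ∧ (Θ-uniq)» this yields **«(F-P2) ⟺ (C)» granted the multiplicity letter** (§5), where
(C) = «`ē_X(p^*P, p^*Q) = ē_Y(P,Q)^{|Δ|}`» = [BirkenhakeLange2004] §12.3 Lemma 12.3.1 read on torsion points: the named fact VI-8 then rests on
that one printed lemma — and since the multiplicity letter IS in the tree (★ `AbelianVariety.exists_sameDivisor_smul_of_support_eq`), §5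
states both (Θ-uniq) and «(F-P2) ⟺ (C)» unconditionally.

## What is proved
* §1 `Jacobian.abelSum_eq_comp_translation`, **`Jacobian.brillNoetherLocus_eq_image_translation`** — change of base point moves the Abel
  sum map and the Brill–Noether locus by a translation ([Milne1986JacobianVarieties] §2 «`f^{P′} = t_{[P−P′]} ∘ f^P`», §6 «if `P` is replaced
  by a second point, `Θ` is replaced by a translate»; over ★ `abelJacobi_eq_mul_const`).
* §2 underlying-space bookkeeping of translations and the support of the pull-back of an effective divisor.
* §3 `AbelianVariety.KTheta_congr_sameDivisor`, `IsPrincipalPolarizationDivisor.congr_sameDivisor` — principal polarisation divisors are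
  stable under `SameDivisor`.
* §4 **`Jacobian.weilPairingLevel_eq_of_isRiemannThetaDivisor_of_mult`** — (Θ-uniq) ⟸ the multiplicity letter, in exactly the shape of
  the (Θ-uniq) conjunct of ★ `Jacobian.galoisCover_pullback_isWeilPairingAdjoint_norm_iff_thetaUniq`.
* §5 **`Jacobian.weilPairingLevel_eq_of_isRiemannThetaDivisor'`** — (Θ-uniq) UNCONDITIONALLY, the letter discharged by ★
  `AbelianVariety.exists_sameDivisor_smul_of_support_eq` (A-p03 (g13), `CartierDivisorMultiplicityOfIrreducibleSupport`), and
  **`Jacobian.galoisCover_pullback_isWeilPairingAdjoint_norm_iff_pullbackPow`** — «(F-P2) ⟺ (C)» in the kernel.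

COUNT-NEUTRAL: nothing here proves (C).  HC_CM is proved only modulo the 7 printed citations until rung 0 closes;
this file moves no book by itself.

## References
* [Lange2023AbelianVarietiesComplex] H. Lange, *Abelian Varieties over the Complex Numbers*, Springer (2023), §4.1.2 Prop. 4.1.2, §4.2.1
  Lemma 4.2.1 (ii) and Cor. 4.2.4, §2.1.1 (p. 68).
* [Milne1986JacobianVarieties] J. S. Milne, *Jacobian Varieties*, in Cornell–Silverman (1986), §2 (after the definition of `f^P`), §5 (the maps
  `f^r`), §6 (`Θ = W^{g−1}`, before Thm. 6.6).
* [MumfordAV1970] D. Mumford, *Abelian Varieties* (1970), §6 Cor. 4 (p. 59), Application 3 (p. 64), Definition (p. 60); §8 (pp. 74–75).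
* [BirkenhakeLange2004] C. Birkenhake, H. Lange, *Complex Abelian Varieties*, 2nd ed. (2004), §12.3 Lemma 12.3.1 (p. 372).
* [Hartshorne1977] R. Hartshorne, *Algebraic Geometry* (1977), II Prop. 6.11 and Prop. 6.2 (Weil vs Cartier divisors on locally factorial schemes).
-/

set_option autoImplicit false

noncomputable section

universe u

open CategoryTheory AlgebraicGeometry
open scoped MonObj

namespace Literature.AlgebraicGeometry.Motives


namespace Jacobian

open Literature.AlgebraicGeometry.RelativeSpec

variable {k : Type u} [Field k] {C : SchemeOver k} (𝒥 : Jacobian C)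

/-! ## §1 Change of base point moves `α_{rP}` and `W̃_r(P)` by a translation -/

/-- Any `k`-morphism followed by the structure morphism of its target is the structure morphism of its source
(restated privately; cf. ★ `AbelianVariety.comp_toSpecOver_eq'`). [folklore] -/
private theorem comp_toSpecOver_eq {Y X : SchemeOver k} (g : Y ⟶ X) : g ≫ toSpecOver X = toSpecOver Y := by
  apply Over.OverMorphism.ext
  change g.left ≫ X.hom = Y.hom
  exact Over.w g

/-- A `T`-valued point times a constant point is that point moved by the translation: `f · Q_T = f ≫ t_Q`
(`t_Q` is multiplication by the constant point). [cite: GortzWedhorn2023, Def. 27.1 (pp. 604–605)] -/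
theorem mul_const_eq_comp_translation {T : SchemeOver k} (f : T ⟶ 𝒥.J.X) (Q : 𝒥.J.Points k) :
    f * (toSpecOver T ≫ Q) = f ≫ 𝒥.J.translation Q := by
  unfold AbelianVariety.translation
  rw [MonObj.comp_mul, Category.comp_id, ← Category.assoc, comp_toSpecOver_eq, mul_comm]

/-- **Change of base point moves the Abel sum map by a translation**: `α_{rP′} = α_{rP} ≫ t_{c^r}` with `c = (f^P(P′))⁻¹ = [P − P′]`
(Milne: `f^{P′} = t_{[P−P′]} ∘ f^P`, ★ `abelJacobi_eq_mul_const`, multiplied over the `r` factors of `C^r`).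
[cite: Milne1986JacobianVarieties, §2 (after the definition of f^P) and §5 (the maps f^r : C^r → J)] -/
theorem abelSum_eq_comp_translation (P P' : AlgPoints C k) (r : ℕ) :
    𝒥.abelSum P' r = 𝒥.abelSum P r ≫ 𝒥.J.translation (((P' ≫ 𝒥.abelJacobi P : 𝒥.J.Points k))⁻¹ ^ r) := by
  rw [← mul_const_eq_comp_translation]
  unfold abelSum
  classical
  set cc : 𝒥.J.Points k := (P' ≫ 𝒥.abelJacobi P)⁻¹ with hcc
  have h : ∀ i : Fin r, (projOver C.hom r i : powOverObj C.hom r ⟶ C) ≫ 𝒥.abelJacobi P' =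
      ((projOver C.hom r i : powOverObj C.hom r ⟶ C) ≫ 𝒥.abelJacobi P) *
        (toSpecOver (powOverObj C.hom r) ≫ cc) := fun i => by
    have h0 := congrArg (fun h => (projOver C.hom r i : powOverObj C.hom r ⟶ C) ≫ h) (𝒥.abelJacobi_eq_mul_const P P')
    have h3 : (projOver C.hom r i : powOverObj C.hom r ⟶ C) ≫ (toSpecOver C ≫ cc) = toSpecOver (powOverObj C.hom r) ≫ cc :=
      (Category.assoc _ _ _).symm.trans (congrArg (· ≫ cc) (comp_toSpecOver_eq _))
    exact h0.trans ((MonObj.comp_mul _ _ _).trans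
      (congrArg (fun t => ((projOver C.hom r i : powOverObj C.hom r ⟶ C) ≫ 𝒥.abelJacobi P) * t) h3))
  simp_rw [h]
  rw [Finset.prod_mul_distrib, Finset.prod_const, Finset.card_univ, Fintype.card_fin, ← MonObj.comp_pow]

/-- **`W̃_r(P′) = t_{c^r}(W̃_r(P))`**, `c = [P − P′]`: the Brill–Noether loci of two base points are translates of one another
(Milne §6: «if `P` is replaced by a second `k`-rational point, `Θ` is replaced by a translate»).
[cite: Milne1986JacobianVarieties, §6 (Θ = W^{g-1}, before Thm. 6.6)] [cite: Lange2023AbelianVarietiesComplex, §4.2.1 Cor. 4.2.4] -/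
theorem brillNoetherLocus_eq_image_translation (P P' : AlgPoints C k) (r : ℕ) :
    𝒥.brillNoetherLocus P' r =
      (𝒥.J.translation (((P' ≫ 𝒥.abelJacobi P : 𝒥.J.Points k))⁻¹ ^ r)).left.base '' 𝒥.brillNoetherLocus P r := by
  unfold brillNoetherLocus
  rw [𝒥.abelSum_eq_comp_translation P P' r, Over.comp_left, Scheme.Hom.comp_base, TopCat.coe_comp, Set.range_comp]
  exact ((Scheme.homeoOfIso (asIso (𝒥.J.translation
    (((P' ≫ 𝒥.abelJacobi P : 𝒥.J.Points k))⁻¹ ^ r)).left)).image_closure _).symm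

/-! ## §2 Translations on the underlying space; the support of a pull-back -/

/-- `t_a(t_b(S)) = t_{ab}(S)` on the underlying space (`t_b ≫ t_a = t_{ab}`, ★ `translation_comp`; cf. ★
`AbelianVariety.image_translation_image_translation` of `JacobianAbelJacobiTranslates`, restated privately in `.left.base` form to keep
that module out of the import cone). [folklore] -/
private theorem image_translation_image_translation' (a b : 𝒥.J.Points k) (S : Set 𝒥.J.X.left) :
    (𝒥.J.translation a).left.base '' ((𝒥.J.translation b).left.base '' S) = (𝒥.J.translation (a * b)).left.base '' S := by
  rw [← AbelianVariety.translation_comp, Over.comp_left, Scheme.Hom.comp_base, TopCat.coe_comp, Set.image_comp]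

/-- `t_a(S) = t_{a⁻¹}⁻¹(S)` on the underlying space (`t_a` is a bijection with inverse `t_{a⁻¹}`). [folklore] -/
private theorem image_translation_eq_preimage (a : 𝒥.J.Points k) (S : Set 𝒥.J.X.left) :
    (𝒥.J.translation a).left.base '' S = (𝒥.J.translation a⁻¹).left.base ⁻¹' S := by
  have h1 : Function.LeftInverse (𝒥.J.translation a⁻¹).left.base (𝒥.J.translation a).left.base := fun p => by
    change ((𝒥.J.translation a).left ≫ (𝒥.J.translation a⁻¹).left) p = p
    rw [← Over.comp_left, AbelianVariety.translation_comp_translation_inv]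
    rfl
  have h2 : Function.RightInverse (𝒥.J.translation a⁻¹).left.base (𝒥.J.translation a).left.base := fun p => by
    change ((𝒥.J.translation a⁻¹).left ≫ (𝒥.J.translation a).left) p = p
    rw [← Over.comp_left, AbelianVariety.translation_inv_comp_translation]
    rfl
  exact congrFun (Set.image_eq_preimage_of_inverse h1 h2) S

/-- `t_1(S) = S`. [folklore] -/
private theorem image_translation_one (S : Set 𝒥.J.X.left) : (𝒥.J.translation 1).left.base '' S = S := by
  rw [AbelianVariety.translation_one]
  exact Set.image_id' S |>.symm ▸ by simp

/-- The support of the pull-back of an EFFECTIVE Cartier divisor along a dominant morphism is the preimage of the support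
(★ `IsEffective.avoids_pullback_iff` with ★ `avoids_iff_mem_nonvanishing_one`). [cite: GortzWedhorn2020, Def. 11.26 (4) and Remark 11.27] -/
theorem _root_.Literature.AlgebraicGeometry.Motives.CartierDivisor.IsEffective.compl_nonvanishing_one_pullback
    {X X' : Scheme.{u}} [IsIntegral X] [IsIntegral X'] {D : CartierDivisor X} (hD : D.IsEffective) (g : X' ⟶ X) [IsDominant g] :
    ((D.pullback g).nonvanishing 1)ᶜ = g.base ⁻¹' (D.nonvanishing 1)ᶜ := by
  ext x
  rw [Set.mem_compl_iff, Set.mem_preimage, Set.mem_compl_iff, ← CartierDivisor.avoids_iff_mem_nonvanishing_one,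
    ← CartierDivisor.avoids_iff_mem_nonvanishing_one, hD.avoids_pullback_iff g]

end Jacobian

/-! ## §3 Principal polarisation divisors are stable under `SameDivisor` -/

namespace AbelianVariety

variable {K : Type u} [Field K] (A : AbelianVariety K)

/-- `K(Θ)` depends only on the divisor, not on its presentation (`D_P(Θ) ≈ D_P(Θ′)`, ★ `weilDiv_congr_sameDivisor`).
[cite: MumfordAV1970, §6 Definition (p. 60) and §8] -/
theorem KTheta_congr_sameDivisor {Θ Θ' : CartierDivisor A.X.left} (h : Θ.SameDivisor Θ') : A.KTheta Θ = A.KTheta Θ' := by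
  ext P
  rw [AbelianVariety.mem_KTheta_iff, AbelianVariety.mem_KTheta_iff]
  exact ⟨fun hP => (A.weilDiv_congr_sameDivisor h P).linEquiv.symm.trans hP,
    fun hP => (A.weilDiv_congr_sameDivisor h P).linEquiv.trans hP⟩

variable {A} in
/-- A principal polarisation divisor stays one under `SameDivisor` (ampleness ★ `LinEquiv.isAmple`, `K(Θ)` above).
[cite: Lange2023AbelianVarietiesComplex, §2.1.1 (p. 68) and §1.4.2 Prop. 1.4.7] -/
theorem IsPrincipalPolarizationDivisor.congr_sameDivisor {Θ Θ' : CartierDivisor A.X.left}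
    (hΘ : A.IsPrincipalPolarizationDivisor Θ) (h : Θ.SameDivisor Θ') : A.IsPrincipalPolarizationDivisor Θ' :=
  ⟨h.linEquiv.isAmple hΘ.1, (A.KTheta_congr_sameDivisor h).symm.trans hΘ.2⟩

end AbelianVariety

/-! ## §4 (Θ-uniq) from the multiplicity letter -/

namespace Jacobian

/-- **(Θ-uniq) ⟸ (multiplicity).**  Granted the multiplicity letter `hmult` — «two EFFECTIVE Cartier divisors on a complex Jacobian
with the SAME IRREDUCIBLE support are, as divisors, `m₁ • D` and `m₂ • D` for one Cartier divisor `D` and positive `m₁`, `m₂`»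
([Hartshorne1977] II Prop. 6.11 / 6.2: on the locally factorial `J` an effective divisor is `Σ nᵢ Yᵢ` over its prime components; here ONE
component) — two Riemann theta divisors `Θ`, `Θ′` of the Jacobian of a smooth projective complex curve (`dim J ≥ 1`) that define
PRINCIPAL polarisations have the same level Weil pairings, `ē_N^Θ(P, Q) = ē_N^{Θ′}(P, Q)` — the canonical polarisation is well defined
whichever theta divisor represents it ([Lange2023AbelianVarietiesComplex] §4.1.2 Prop. 4.1.2, Cor. 4.2.4; = the (Θ-uniq) conjunct of ★
`Jacobian.galoisCover_pullback_isWeilPairingAdjoint_norm_iff_thetaUniq` behind the binder `hmult`).  Proof: supports are translates of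
`W̃_{g−1}` (§1), so a TRANSLATE `Θ″ = t^*Θ` has the support of `Θ′`, keeps `ē` (★ `weilPairingLevel_pullback_translation`) and stays
principal (★ `IsPrincipalPolarizationDivisor.pullback_translation`); the support is irreducible (★ `isIrreducible_brillNoetherLocus`), so
`Θ″ ≈ m″ • D`, `Θ′ ≈ m′ • D` by `hmult`, and `m″ = m′ = 1` by ★ `eq_one_of_isPrincipalPolarizationDivisor_smul`.
[cite: Lange2023AbelianVarietiesComplex, §4.1.2 Prop. 4.1.2 and §4.2.1 Cor. 4.2.4] [cite: Milne1986JacobianVarieties, §6 (Θ = W^{g-1}, before Thm. 6.6)]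
[cite: MumfordAV1970, §6 Cor. 4 (p. 59) and §8 (pp. 74–75)] [cite: Hartshorne1977, II Prop. 6.11] -/
theorem weilPairingLevel_eq_of_isRiemannThetaDivisor_of_mult
    (hmult : ∀ (X : SchemeOver ℂ) (𝒥 : Jacobian X) (E₁ E₂ : CartierDivisor 𝒥.J.X.left), E₁.IsEffective → E₂.IsEffective →
      (E₁.nonvanishing 1)ᶜ = (E₂.nonvanishing 1)ᶜ → IsIrreducible (E₁.nonvanishing 1)ᶜ →
      ∃ (D : CartierDivisor 𝒥.J.X.left) (m₁ m₂ : ℕ), 0 < m₁ ∧ 0 < m₂ ∧ E₁.SameDivisor (m₁ • D) ∧ E₂.SameDivisor (m₂ • D))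
    (X : SchemeOver ℂ) (hX : IsSmoothProjective 1 X) (𝒥 : Jacobian X) (hdim : 1 ≤ 𝒥.J.dim)
    (Θ Θ' : CartierDivisor 𝒥.J.X.left)
    (h1 : 𝒥.IsRiemannThetaDivisor Θ) (h2 : 𝒥.J.IsPrincipalPolarizationDivisor Θ)
    (h3 : 𝒥.IsRiemannThetaDivisor Θ') (h4 : 𝒥.J.IsPrincipalPolarizationDivisor Θ')
    (N : ℕ) [IsDominant (AbelianVariety.Hom.toSchemeHom ((N : ℤ) • 𝟙 𝒥.J))] (P Q : 𝒥.J.torsionPoints ℂ N) :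
    𝒥.J.weilPairingLevel Θ P Q = 𝒥.J.weilPairingLevel Θ' P Q := by
  have hirrΘ' : IsIrreducible (Θ'.nonvanishing 1)ᶜ := h3.isIrreducible_support hX
  obtain ⟨hΘ, P₀, x, hsupp⟩ := h1
  obtain ⟨hΘ', P₀', x', hsupp'⟩ := h3
  -- the two supports are translates of one another: `supp Θ′ = t_y(supp Θ)`
  set c : 𝒥.J.Points ℂ := ((P₀' ≫ 𝒥.abelJacobi P₀ : 𝒥.J.Points ℂ))⁻¹ ^ (𝒥.J.dim - 1) with hc
  set y : 𝒥.J.Points ℂ := x' * c * x⁻¹ with hy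
  have hW : 𝒥.brillNoetherLocus P₀ (𝒥.J.dim - 1) = (𝒥.J.translation x⁻¹).left.base '' (Θ.nonvanishing 1)ᶜ := by
    rw [hsupp, image_translation_image_translation', inv_mul_cancel, image_translation_one]
  have hsupp_y : (Θ'.nonvanishing 1)ᶜ = (𝒥.J.translation y).left.base '' (Θ.nonvanishing 1)ᶜ := by
    rw [hsupp', 𝒥.brillNoetherLocus_eq_image_translation P₀ P₀', hW, image_translation_image_translation',
      image_translation_image_translation', hy, hc, mul_assoc]
  -- the translate `Θ″ := t_{y⁻¹}^* Θ` has the support of `Θ′`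
  set Θ'' : CartierDivisor 𝒥.J.X.left := Θ.pullback (𝒥.J.translation y⁻¹).left with hΘ''
  have hΘ''eff : Θ''.IsEffective := hΘ.pullback _
  have hsupp'' : (Θ''.nonvanishing 1)ᶜ = (Θ'.nonvanishing 1)ᶜ := by
    rw [hΘ'', hΘ.compl_nonvanishing_one_pullback, hsupp_y, image_translation_eq_preimage]
  -- the common support is irreducible (★ `IsRiemannThetaDivisor.isIrreducible_support`)
  have hirr : IsIrreducible (Θ''.nonvanishing 1)ᶜ := hsupp'' ▸ hirrΘ'
  -- the multiplicity letter: `Θ″ ≈ m″ • D`, `Θ′ ≈ m′ • D`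
  obtain ⟨D, m'', m', hm'', hm', hΘ''D, hΘ'D⟩ := hmult X 𝒥 Θ'' Θ' hΘ''eff hΘ' hsupp'' hirr
  -- both are principal polarisations, so `m″ = m′ = 1`
  have hp'' : 𝒥.J.IsPrincipalPolarizationDivisor (m'' • D) := (h2.pullback_translation _).congr_sameDivisor hΘ''D
  have hp' : 𝒥.J.IsPrincipalPolarizationDivisor (m' • D) := h4.congr_sameDivisor hΘ'D
  have e'' : m'' = 1 := 𝒥.J.eq_one_of_isPrincipalPolarizationDivisor_smul hdim D hm''.ne' hp''
  have e' : m' = 1 := 𝒥.J.eq_one_of_isPrincipalPolarizationDivisor_smul hdim D hm'.ne' hp'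
  rw [e''] at hΘ''D
  rw [e'] at hΘ'D
  rw [CartierDivisor.one_smul] at hΘ''D hΘ'D
  -- `ē^Θ = ē^{Θ″}` (translate) `= ē^D = ē^{Θ′}`
  calc 𝒥.J.weilPairingLevel Θ P Q
      = 𝒥.J.weilPairingLevel Θ'' P Q := (AbelianVariety.weilPairingLevel_pullback_translation Θ y⁻¹ P Q).symm
    _ = 𝒥.J.weilPairingLevel D P Q := AbelianVariety.weilPairingLevel_congr_sameDivisor hΘ''D P Q
    _ = 𝒥.J.weilPairingLevel Θ' P Q := (AbelianVariety.weilPairingLevel_congr_sameDivisor hΘ'D P Q).symm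

/-! ## §5 Unconditionally: (Θ-uniq), and «(F-P2) ⟺ (C)» -/

/-- **(Θ-uniq), fact-free.**  Two Riemann theta divisors of the Jacobian of a smooth projective complex curve (`dim J ≥ 1`) defining
PRINCIPAL polarisations have the same level Weil pairings — the canonical polarisation of `J(C)` is well defined whichever theta divisor
represents it ([Lange2023AbelianVarietiesComplex] §4.1.2 Prop. 4.1.2, Cor. 4.2.4); §4 with the multiplicity letter DISCHARGED by ★
`AbelianVariety.exists_sameDivisor_smul_of_support_eq` (A-p03 (g13), `CartierDivisorMultiplicityOfIrreducibleSupport`: an effective Cartier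
divisor on the regular `J` with irreducible support is a multiple of the prime divisor of that support, [Hartshorne1977] II 6.11).  This is ★
`Jacobian.weilPairingLevel_eq_of_isRiemannThetaDivisor` WITHOUT its hypothesis `(hFP2 : galoisCover_pullback_isWeilPairingAdjoint_norm)`.
[cite: Lange2023AbelianVarietiesComplex, §4.1.2 Prop. 4.1.2 and §4.2.1 Cor. 4.2.4] [cite: Milne1986JacobianVarieties, §6 (Θ = W^{g-1}, before Thm. 6.6)]
[cite: Hartshorne1977, II Prop. 6.11] -/
theorem weilPairingLevel_eq_of_isRiemannThetaDivisor' {X : SchemeOver ℂ} (hX : IsSmoothProjective 1 X) (𝒥 : Jacobian X)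
    (hdim : 1 ≤ 𝒥.J.dim) {Θ Θ' : CartierDivisor 𝒥.J.X.left}
    (h1 : 𝒥.IsRiemannThetaDivisor Θ) (h2 : 𝒥.J.IsPrincipalPolarizationDivisor Θ)
    (h3 : 𝒥.IsRiemannThetaDivisor Θ') (h4 : 𝒥.J.IsPrincipalPolarizationDivisor Θ')
    (N : ℕ) [IsDominant (AbelianVariety.Hom.toSchemeHom ((N : ℤ) • 𝟙 𝒥.J))] (P Q : 𝒥.J.torsionPoints ℂ N) :
    𝒥.J.weilPairingLevel Θ P Q = 𝒥.J.weilPairingLevel Θ' P Q :=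
  weilPairingLevel_eq_of_isRiemannThetaDivisor_of_mult
    (fun _ 𝒥₁ E₁ E₂ h₁ h₂ hs hi => 𝒥₁.J.exists_sameDivisor_smul_of_support_eq E₁ E₂ h₁ h₂ hs hi)
    X hX 𝒥 hdim Θ Θ' h1 h2 h3 h4 N P Q

/-- **«(F-P2) ⟺ (C)» IN THE KERNEL.**  The named fact ★ `Jacobian.galoisCover_pullback_isWeilPairingAdjoint_norm` (fan-B row VI-8: for a
Galois cover `p : X → Y = X/Δ` of smooth projective complex curves, `p^*` is the `ē_N`-adjoint of `Nm_p` for the canonical principal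
polarisations, [LangeRodriguez2022] (3.3), [Lange2023AbelianVarietiesComplex] (4.9)) is EQUIVALENT to the single cover statement (C)
«`ē_N^{Θ_X}(p^*P, p^*Q) = ē_N^{Θ_Y}(P, Q)^{|Δ|}`» = [BirkenhakeLange2004] §12.3 Lemma 12.3.1 «`(f^*)^*Θ̃ ≡ dΘ`» read on torsion points
(binders verbatim those of the fact): ★ A-p04 (g17)'s `galoisCover_pullback_isWeilPairingAdjoint_norm_iff_thetaUniq` with its (Θ-uniq)
conjunct discharged by `weilPairingLevel_eq_of_isRiemannThetaDivisor'`.  COUNT-NEUTRAL (nothing here proves (C)).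
[cite: BirkenhakeLange2004, §12.3 Lemma 12.3.1 (p. 372)] [cite: LangeRodriguez2022, §3.2.1 eq. (3.3) (pp. 46–47); §3.5.1 Prop. 3.5.1 (p. 65)]
[cite: Lange2023AbelianVarietiesComplex, §4.1.2 Prop. 4.1.2 and §4.2.1 Cor. 4.2.4] -/
theorem galoisCover_pullback_isWeilPairingAdjoint_norm_iff_pullbackPow :
    galoisCover_pullback_isWeilPairingAdjoint_norm ↔
      (∀ (X Y : SchemeOver ℂ), IsSmoothProjective 1 X → IsSmoothProjective 1 Y →
        ∀ (𝒥X : Jacobian X) (𝒥Y : Jacobian Y), 1 ≤ 𝒥Y.J.dim →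
        ∀ (Δ : Type) [Group Δ] [Fintype Δ] (act : Δ →* Aut X), Function.Injective act →
        ∀ (p : X ⟶ Y), IsSepQuotient (fun δ : Δ => act δ) p →
        ∀ (ΘX : CartierDivisor 𝒥X.J.X.left) (ΘY : CartierDivisor 𝒥Y.J.X.left),
          𝒥X.IsRiemannThetaDivisor ΘX → 𝒥X.J.IsPrincipalPolarizationDivisor ΘX →
          𝒥Y.IsRiemannThetaDivisor ΘY → 𝒥Y.J.IsPrincipalPolarizationDivisor ΘY →
        ∀ (t : 𝒥Y.J ⟶ 𝒥X.J), 𝒥X.pushforward 𝒥Y p ≫ t = ∑ δ : Δ, 𝒥X.pushforward 𝒥X (act δ).hom →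
        ∀ (N : ℕ) [IsDominant (AbelianVariety.Hom.toSchemeHom ((N : ℤ) • 𝟙 𝒥X.J))]
          [IsDominant (AbelianVariety.Hom.toSchemeHom ((N : ℤ) • 𝟙 𝒥Y.J))]
          (P Q : 𝒥Y.J.torsionPoints ℂ N),
          𝒥X.J.weilPairingLevel ΘX ⟨AlgPoints.map t.hom.hom.hom P.1, AbelianVariety.map_mem_torsionPoints t P.2⟩
              ⟨AlgPoints.map t.hom.hom.hom Q.1, AbelianVariety.map_mem_torsionPoints t Q.2⟩ =
            𝒥Y.J.weilPairingLevel ΘY P Q ^ Fintype.card Δ) := by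
  rw [galoisCover_pullback_isWeilPairingAdjoint_norm_iff_thetaUniq]
  exact and_iff_left fun X hX 𝒥 hdim Θ Θ' h1 h2 h3 h4 N _ P Q =>
    weilPairingLevel_eq_of_isRiemannThetaDivisor' hX 𝒥 hdim h1 h2 h3 h4 N P Q

end Jacobian

end Literature.AlgebraicGeometry.Motives

end
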